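import Literature.NumberTheory.Transcendental.HermiteInterpolationBound
import HarnessLib

/-!
# Cijsouw–Waldschmidt 1977, Lemma 2 at integer points

Support file (theorems only) for the proof of Cijsouw–Waldschmidt 1977, Proposition 1 over `ℚ`.
Their Lemma 2 (pp. 179–180) is the Schwarz lemma with multiplicities: for `f` analytic on
`|z| ≤ R`, a set `E` of `k` points on a line in `|z| ≤ r ≤ R/2` with mutual distances `≥ δ`, and
`t ≥ 1`, `|f|_{2r} ≤ 2|f|_R (4r/R)^{kt} + 5 (18r/(δk))^{kt} max_{x ∈ E, τ < t} |f^{(τ)}(x)/τ!|`.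
In the proof of Proposition 1 it is applied with `E` = integer points, `δ = 1`, `R = 6r` (p. 189).
We derive that case from the tree's Hermite extrapolation estimate
`Hermite.norm_le_of_small_jets` (`HermiteInterpolationBound.lean`), whose parameter `Λ₀` (a lower
bound for `∏_{e' ≠ e} |e − e'|`) is here `(k−1)!/2^{k−1}`: for the points `0, 1, …, k−1` and `e = i`
the product is `i! (k−1−i)! = (k−1)!/binom(k−1, i) ≥ (k−1)!/2^{k−1}` (`prod_norm_sub_natCast`,
`factorial_le_two_pow_mul`); the factor `kᵏ/k! ≤ eᵏ` then turns `(28k)^{kt}/((k−1)!)^t` into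
`k^t (28e)^{kt}` — Cijsouw–Waldschmidt's "`(18r/(δk))^{kt}`".

* `CW77.hermite_integer_points`: `f` entire, `k, t ≥ 1`, `|f^{(σ)}(i)| ≤ ε` for `i < k`, `σ < t`,
  `|f| ≤ B_f` on `|z| = 6k` ⇒ `|f(w)| ≤ 2 k^{t+1} t (28e)^{kt} ε + B_f (3/5)^{kt}` for `|w| ≤ 2k`.

## References

* [CijsouwWaldschmidt1977] P. L. Cijsouw, M. Waldschmidt, *Linear forms and simultaneous
  approximations*, Compositio Math. 34 (1977), 173–197 — Lemma 2 (pp. 179–180), p. 189.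
-/

noncomputable section

open Finset Real

namespace Literature.NumberTheory.Transcendental.CW77

/-! ### Products of distances between integer points -/

/-- `∏_{j < i} (i − j) = i!`. [folklore] -/
theorem prod_range_sub_eq_factorial (i : ℕ) : ∏ j ∈ range i, ((i : ℝ) - j) = (i.factorial : ℝ) := by
  have h : ∀ j ∈ range i, ((i : ℝ) - j) = (((i - 1 - j) + 1 : ℕ) : ℝ) := by
    intro j hj
    have hji : j < i := mem_range.mp hj
    have : (i - 1 - j) + 1 = i - j := by omega
    rw [this, Nat.cast_sub hji.le]
  rw [prod_congr rfl h, ← Nat.cast_prod, Finset.prod_range_reflect (fun j => j + 1) i,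
    Finset.prod_range_add_one_eq_factorial]

/-- `∏_{i < j < k} (j − i) = (k−1−i)!`. [folklore] -/
theorem prod_Ico_sub_eq_factorial (i k : ℕ) :
    ∏ j ∈ Ico (i + 1) k, ((j : ℝ) - i) = ((k - 1 - i).factorial : ℝ) := by
  rw [Finset.prod_Ico_eq_prod_range]
  have h : ∀ m ∈ range (k - (i + 1)), (((i + 1 + m : ℕ) : ℝ) - i) = ((m + 1 : ℕ) : ℝ) := by
    intro m _; push_cast; ring
  rw [prod_congr rfl h, ← Nat.cast_prod, Finset.prod_range_add_one_eq_factorial]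
  congr 2; omega

/-- **`∏_{j < k, j ≠ i} |i − j| = i! (k−1−i)!`** for `i < k` (as complex norms of the integer
points). [folklore] -/
theorem prod_norm_sub_natCast {k i : ℕ} (hi : i < k) :
    ∏ e' ∈ ((range k).image (fun j : ℕ => (j : ℂ))).erase (i : ℂ), ‖(i : ℂ) - e'‖ =
      (i.factorial : ℝ) * (k - 1 - i).factorial := by
  have hinj : Function.Injective (fun j : ℕ => (j : ℂ)) := Nat.cast_injective
  rw [← Finset.image_erase hinj (range k) i, Finset.prod_image (fun x _ y _ h => hinj h)]
  have hnorm : ∀ j ∈ (range k).erase i, ‖(i : ℂ) - (j : ℂ)‖ = |((i : ℝ) - j)| := by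
    intro j _
    rw [← Complex.ofReal_natCast, ← Complex.ofReal_natCast, ← Complex.ofReal_sub,
      Complex.norm_real, Real.norm_eq_abs]
  rw [prod_congr rfl hnorm]
  -- split the range at `i`
  have hsplit : (range k).erase i = range i ∪ Ico (i + 1) k := by
    ext j
    simp only [mem_erase, mem_range, mem_union, mem_Ico]
    omega
  have hdisj : Disjoint (range i) (Ico (i + 1) k) := by
    rw [Finset.disjoint_left]
    intro j hj hj'
    simp only [mem_range] at hj
    simp only [mem_Ico] at hj'
    omega
  rw [hsplit, prod_union hdisj]
  have h1 : ∏ j ∈ range i, |((i : ℝ) - j)| = ∏ j ∈ range i, ((i : ℝ) - j) := by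
    refine prod_congr rfl fun j hj => abs_of_nonneg ?_
    have := (mem_range.mp hj).le
    exact sub_nonneg.mpr (by exact_mod_cast this)
  have h2 : ∏ j ∈ Ico (i + 1) k, |((i : ℝ) - j)| = ∏ j ∈ Ico (i + 1) k, ((j : ℝ) - i) := by
    refine prod_congr rfl fun j hj => ?_
    have := (mem_Ico.mp hj).1
    rw [abs_sub_comm]
    exact abs_of_nonneg (sub_nonneg.mpr (by exact_mod_cast (by omega : i ≤ j)))
  rw [h1, h2, prod_range_sub_eq_factorial, prod_Ico_sub_eq_factorial]

/-- `N! ≤ 2^N · i! (N−i)!` (`binom(N, i) ≤ 2^N`). [folklore] -/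
theorem factorial_le_two_pow_mul {i N : ℕ} (hi : i ≤ N) :
    (N.factorial : ℝ) ≤ 2 ^ N * (i.factorial * (N - i).factorial) := by
  have h := Nat.choose_mul_factorial_mul_factorial hi
  have h2 := Nat.choose_le_two_pow N i
  have : (N.factorial : ℝ) = (N.choose i : ℝ) * (i.factorial * (N - i).factorial) := by
    rw [← h]; push_cast; ring
  rw [this]
  exact mul_le_mul_of_nonneg_right (by exact_mod_cast h2) (by positivity)

/-- `kᵏ ≤ eᵏ k!`. [folklore] -/
theorem pow_self_le_exp_mul_factorial (k : ℕ) : (k : ℝ) ^ k ≤ Real.exp 1 ^ k * k.factorial := by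
  have h := Real.pow_div_factorial_le_exp (k : ℝ) (Nat.cast_nonneg k) k
  rw [div_le_iff₀ (by positivity)] at h
  rw [← Real.exp_one_pow] at h
  linarith

/-! ### The extrapolation estimate at integer points -/

/-- **Cijsouw–Waldschmidt's Lemma 2 for integer points** (`δ = 1`, radii `r = k`, `2k`, `6k`):
if `f` is entire, `|f^{(σ)}(i)| ≤ ε` for all integers `0 ≤ i < k` and `σ < t` (`k, t ≥ 1`), and
`|f| ≤ B_f` on `|z| = 6k`, then `|f(w)| ≤ 2 k^{t+1} t (28e)^{kt} ε + B_f (3/5)^{kt}` for `|w| ≤ 2k`.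
[cite: CijsouwWaldschmidt1977, Lemma 2 (pp. 179–180), p. 189] -/
theorem hermite_integer_points {f : ℂ → ℂ} (hf : Differentiable ℂ f) {k t : ℕ} (hk : 1 ≤ k)
    (ht : 1 ≤ t) {ε Bf : ℝ} (hε : 0 ≤ ε)
    (hsmall : ∀ i : ℕ, i < k → ∀ σ, σ < t → ‖iteratedDeriv σ f (i : ℂ)‖ ≤ ε)
    (hB : ∀ z ∈ Metric.sphere (0 : ℂ) (6 * k), ‖f z‖ ≤ Bf) {w : ℂ} (hw : ‖w‖ ≤ 2 * k) :
    ‖f w‖ ≤ 2 * (k : ℝ) ^ (t + 1) * t * (28 * Real.exp 1) ^ (k * t) * ε + Bf * (3 / 5) ^ (k * t) := by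
  classical
  set E : Finset ℂ := (range k).image (fun j : ℕ => (j : ℂ)) with hE
  have hinj : Function.Injective (fun j : ℕ => (j : ℂ)) := Nat.cast_injective
  have hcard : E.card = k := by rw [hE, card_image_of_injective _ hinj, card_range]
  set Λ₀ : ℝ := (k - 1).factorial / 2 ^ (k - 1) with hΛ₀
  have hΛ₀pos : 0 < Λ₀ := by rw [hΛ₀]; positivity
  have hk1 : (1 : ℝ) ≤ k := by exact_mod_cast hk
  have hk0 : (0 : ℝ) < k := by linarith
  -- hypotheses of the Hermite estimate
  have hEr : ∀ e ∈ E, ‖e‖ ≤ (k : ℝ) := by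
    intro e he
    obtain ⟨j, hj, rfl⟩ := mem_image.mp he
    rw [Complex.norm_natCast]
    exact_mod_cast (mem_range.mp hj).le
  have hsep : ∀ e₁ ∈ E, ∀ e₂ ∈ E, e₁ ≠ e₂ → (1 : ℝ) ≤ ‖e₁ - e₂‖ := by
    intro e₁ he₁ e₂ he₂ hne
    obtain ⟨j₁, _, rfl⟩ := mem_image.mp he₁
    obtain ⟨j₂, _, rfl⟩ := mem_image.mp he₂
    have hne' : j₁ ≠ j₂ := fun h => hne (by rw [h])
    rw [← Complex.ofReal_natCast, ← Complex.ofReal_natCast, ← Complex.ofReal_sub, Complex.norm_real,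
      Real.norm_eq_abs, ← Int.cast_natCast, ← Int.cast_natCast (R := ℝ) j₂, ← Int.cast_sub,
      ← Int.cast_abs]
    have : (1 : ℤ) ≤ |(j₁ : ℤ) - j₂| := Int.one_le_abs (sub_ne_zero.mpr (by exact_mod_cast hne'))
    exact_mod_cast this
  have hprod : ∀ e ∈ E, Λ₀ ≤ ∏ e' ∈ E.erase e, ‖e - e'‖ := by
    intro e he
    obtain ⟨i, hi, rfl⟩ := mem_image.mp he
    have hi' := mem_range.mp hi
    rw [hE, prod_norm_sub_natCast hi', hΛ₀, div_le_iff₀ (by positivity)]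
    have := factorial_le_two_pow_mul (show i ≤ k - 1 by omega)
    have hki : k - 1 - i = (k - 1) - i := rfl
    calc ((k - 1).factorial : ℝ) ≤ 2 ^ (k - 1) * (i.factorial * ((k - 1) - i).factorial) := this
      _ = (i.factorial : ℝ) * (k - 1 - i).factorial * 2 ^ (k - 1) := by ring
  have hsmall' : ∀ e ∈ E, ∀ σ < t, ‖iteratedDeriv σ f e‖ ≤ ε := by
    intro e he σ hσ
    obtain ⟨i, hi, rfl⟩ := mem_image.mp he
    exact hsmall i (mem_range.mp hi) σ hσ
  have key := Hermite.norm_le_of_small_jets hf E t (r := k) (R := 6 * k) (ρ := 2 * k) (δ := 1)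
    hk1 (by positivity) (by linarith) (by linarith) one_pos le_rfl hΛ₀pos hε hEr hsep hprod hsmall' hB hw
  rw [hcard] at key
  -- simplify the two terms
  have h2δ : ((2 : ℝ) / 1) ^ t = 2 ^ t := by rw [div_one]
  rw [h2δ] at key
  have hratio : ((2 * (k : ℝ) + k) / (6 * k - k)) = 3 / 5 := by
    field_simp; ring
  rw [hratio] at key
  -- the factor `(c k)^{tk} 2^t / Λ₀^t ≤ k^t (2ce)^{kt}` for `c = 6, 14`
  have hfac : ∀ c : ℝ, 0 ≤ c → (2 * (c * k)) ^ (t * k) * 2 ^ t / Λ₀ ^ t ≤ (k : ℝ) ^ t * (4 * c * Real.exp 1) ^ (k * t) := by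
    intro c hc
    rw [hΛ₀, div_pow, div_div_eq_mul_div, ← pow_mul, div_le_iff₀ (by positivity)]
    -- `(2ck)^{tk} 2^t 2^{(k-1)t} ≤ k^t (4ce)^{kt} ((k-1)!)^t`
    have hk' : ((k - 1).factorial : ℝ) * k = k.factorial := by
      rw [mul_comm]; exact_mod_cast Nat.mul_factorial_pred (by omega)
    -- per unit of `t`: `(2ck)^k · 2 · 2^{k-1} = (4ck)^k ≤ k (4ce)^k (k-1)!`
    have hunit : (2 * (c * k)) ^ k * 2 * 2 ^ (k - 1) ≤ (k : ℝ) * (4 * c * Real.exp 1) ^ k * (k - 1).factorial := by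
      have h22 : (2 * (c * (k : ℝ))) ^ k * 2 * 2 ^ (k - 1) = (4 * c) ^ k * (k : ℝ) ^ k := by
        have : (2 : ℝ) * 2 ^ (k - 1) = 2 ^ k := by
          rw [← pow_succ']; congr 1; omega
        calc (2 * (c * (k : ℝ))) ^ k * 2 * 2 ^ (k - 1) = (2 * (c * k)) ^ k * (2 * 2 ^ (k - 1)) := by ring
          _ = (2 * (c * k)) ^ k * 2 ^ k := by rw [this]
          _ = (2 * (c * k) * 2) ^ k := by rw [← mul_pow]
          _ = (4 * c * k) ^ k := by ring_nf
          _ = (4 * c) ^ k * (k : ℝ) ^ k := by rw [← mul_pow]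
      rw [h22]
      have hkk := pow_self_le_exp_mul_factorial k
      calc (4 * c) ^ k * (k : ℝ) ^ k ≤ (4 * c) ^ k * (Real.exp 1 ^ k * k.factorial) :=
            mul_le_mul_of_nonneg_left hkk (by positivity)
        _ = (4 * c * Real.exp 1) ^ k * (((k - 1).factorial : ℝ) * k) := by rw [hk', mul_pow]; ring
        _ = (k : ℝ) * (4 * c * Real.exp 1) ^ k * (k - 1).factorial := by ring
    rw [pow_mul (2 : ℝ) (k - 1) t, mul_comm t k, pow_mul (2 * (c * (k : ℝ))) k t, ← mul_pow, ← mul_pow]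
    calc ((2 * (c * ↑k)) ^ k * 2 * 2 ^ (k - 1)) ^ t
        ≤ ((k : ℝ) * (4 * c * Real.exp 1) ^ k * (k - 1).factorial) ^ t :=
          pow_le_pow_left₀ (by positivity) hunit t
      _ = (k : ℝ) ^ t * (4 * c * Real.exp 1) ^ (k * t) * ((k - 1).factorial : ℝ) ^ t := by
          rw [mul_pow, mul_pow, ← pow_mul]
  have hA := hfac 3 (by norm_num)   -- ρ + r = 3k : 2(ρ+r) = 2(3k)
  have hBt := hfac 7 (by norm_num)  -- R + r = 7k
  -- rewrite `key` in terms of these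
  have e1 : (2 * (2 * (k : ℝ) + k)) = 2 * (3 * k) := by ring
  have e2 : (2 * (6 * (k : ℝ) + k)) = 2 * (7 * k) := by ring
  rw [e1, e2] at key
  have h35 : (0 : ℝ) ≤ (3 / 5) ^ (t * k) := by positivity
  have h35' : ((3 : ℝ) / 5) ^ (t * k) ≤ 1 := pow_le_one₀ (by norm_num) (by norm_num)
  have hBf0 : 0 ≤ Bf := by
    have hz : ((6 * k : ℝ) : ℂ) ∈ Metric.sphere (0 : ℂ) (6 * k) := by
      simp
    exact (norm_nonneg _).trans (hB _ hz)
  -- first term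
  have T1 : (k : ℝ) * t * ε * (2 * (3 * k)) ^ (t * k) * 2 ^ t / Λ₀ ^ t ≤
      (k : ℝ) ^ (t + 1) * t * (28 * Real.exp 1) ^ (k * t) * ε := by
    have : (k : ℝ) * t * ε * (2 * (3 * k)) ^ (t * k) * 2 ^ t / Λ₀ ^ t =
        (k * t * ε) * ((2 * (3 * k)) ^ (t * k) * 2 ^ t / Λ₀ ^ t) := by ring
    rw [this]
    have h12 : (k : ℝ) ^ t * (4 * 3 * Real.exp 1) ^ (k * t) ≤ (k : ℝ) ^ t * (28 * Real.exp 1) ^ (k * t) := by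
      apply mul_le_mul_of_nonneg_left _ (by positivity)
      apply pow_le_pow_left₀ (by positivity)
      nlinarith [Real.exp_pos 1]
    calc (k * t * ε) * ((2 * (3 * (k : ℝ))) ^ (t * k) * 2 ^ t / Λ₀ ^ t)
        ≤ (k * t * ε) * ((k : ℝ) ^ t * (28 * Real.exp 1) ^ (k * t)) :=
          mul_le_mul_of_nonneg_left (hA.trans h12) (by positivity)
      _ = (k : ℝ) ^ (t + 1) * t * (28 * Real.exp 1) ^ (k * t) * ε := by ring
  -- second term
  have T2 : (Bf + (k : ℝ) * t * ε * (2 * (7 * k)) ^ (t * k) * 2 ^ t / Λ₀ ^ t) * (3 / 5) ^ (t * k) ≤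
      Bf * (3 / 5) ^ (k * t) + (k : ℝ) ^ (t + 1) * t * (28 * Real.exp 1) ^ (k * t) * ε := by
    have hsecond : (k : ℝ) * t * ε * (2 * (7 * k)) ^ (t * k) * 2 ^ t / Λ₀ ^ t ≤
        (k : ℝ) ^ (t + 1) * t * (28 * Real.exp 1) ^ (k * t) * ε := by
      have : (k : ℝ) * t * ε * (2 * (7 * k)) ^ (t * k) * 2 ^ t / Λ₀ ^ t =
          (k * t * ε) * ((2 * (7 * k)) ^ (t * k) * 2 ^ t / Λ₀ ^ t) := by ring
      rw [this]
      have h28 : (4 * 7 * Real.exp 1) = 28 * Real.exp 1 := by ring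
      rw [h28] at hBt
      calc (k * t * ε) * ((2 * (7 * (k : ℝ))) ^ (t * k) * 2 ^ t / Λ₀ ^ t)
          ≤ (k * t * ε) * ((k : ℝ) ^ t * (28 * Real.exp 1) ^ (k * t)) :=
            mul_le_mul_of_nonneg_left hBt (by positivity)
        _ = (k : ℝ) ^ (t + 1) * t * (28 * Real.exp 1) ^ (k * t) * ε := by ring
    have hnn : 0 ≤ (k : ℝ) ^ (t + 1) * t * (28 * Real.exp 1) ^ (k * t) * ε := by positivity
    calc (Bf + (k : ℝ) * t * ε * (2 * (7 * k)) ^ (t * k) * 2 ^ t / Λ₀ ^ t) * (3 / 5) ^ (t * k)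
        ≤ (Bf + (k : ℝ) ^ (t + 1) * t * (28 * Real.exp 1) ^ (k * t) * ε) * (3 / 5) ^ (t * k) :=
          mul_le_mul_of_nonneg_right (add_le_add le_rfl hsecond) h35
      _ = Bf * (3 / 5) ^ (t * k) + ((k : ℝ) ^ (t + 1) * t * (28 * Real.exp 1) ^ (k * t) * ε) * (3 / 5) ^ (t * k) := by ring
      _ ≤ Bf * (3 / 5) ^ (t * k) + ((k : ℝ) ^ (t + 1) * t * (28 * Real.exp 1) ^ (k * t) * ε) * 1 := by
          gcongr
      _ = Bf * (3 / 5) ^ (k * t) + (k : ℝ) ^ (t + 1) * t * (28 * Real.exp 1) ^ (k * t) * ε := by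
          rw [mul_comm k t, mul_one]
  linarith [key, T1, T2]

end Literature.NumberTheory.Transcendental.CW77
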